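import Summits.RiemannHypothesis.RiemannHypothesis.Theorems.WeilFormatCWindowGram
import Summits.RiemannHypothesis.RiemannHypothesis.Theorems.WeilFormatCSectorSplit
import HarnessLib

/-!
# Format C: from the two real SECTOR KERNELS on `ℕ` to a rung `WeilPositivityOn a`

Route context: Fourier–Galerkin / Schur-complement certificates of Weil positivity on a window ("format C";
cell memo `run/shared/lean/pub/rh-explicit/rh-explicit-weil-10/FORMATC-DESIGN.md` §1 (c4); supporting
stmt-RiemannHypothesis-0098; seat rh-explicit-weil-10).  This file composes three landed pieces into the statement a
per-sector format-C certificate actually targets: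

* weil-3's dictionary `WeilFormatC.weilPositivityOn_of_real_gram_psd` (`WeilFormatCWindowGram.lean`): real Gram
  entries + `∀ N`, real PSD on `modes N = {−N,…,N}` ⟹ `WeilPositivityOn a`;
* weil-2's sector split `WeilFormatC.sum_modes_mul_mul_eq_sectors` (`WeilFormatCSectorSplit.lean`): for a
  reflection-symmetric real kernel `G` on `ℤ`, the quadratic form on `modes N` is the EVEN sector form on `{0,…,N}` plus
  the ODD sector form on `{1,…,N}` (indexed by `{0,…,N−1}`);
* the per-sector `∀ N` statement `∀ N y, 0 ≤ Σ_{n,m<N} y_n y_m M(n,m)` — the conclusion of the soundness theorem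
  `WeilFormatC.sum_range_mul_mul_nonneg_of_certificate` (`WeilFormatCSoundness.lean`, same seat).

Main results (namespace `…Theorems.WeilFormatC`; the Gram kernel `G : ℤ → ℤ → ℝ` is ABSTRACT here, tied to the window
form by the hypothesis `weilWindowSesq a χ_m χ_n = ↑(G m n)` — discharged for `G = Yoshida1992.gramCoeff a` by
weil-2's entry theorem, L-C1):

* `sum_modes_mul_mul_nonneg_of_sector_kernels` — even kernel `M⁺_G` and odd kernel `M⁻_G` (written out below)
  nonnegative as real quadratic forms on every `range K` ⟹ `0 ≤ Σ_{n,m ∈ modes N} x_n x_m G(n,m)` for all real `x`;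
* `weilPositivityOn_of_sector_kernels_nonneg` — **the rung**: `a > 0`, `weilWindowSesq a χ_m χ_n = ↑(G m n)`,
  `G(−n,−m) = G(n,m)`, and the two sector kernels nonnegative on every `range K` ⟹ `WeilPositivityOn a`.

The sector kernels, for `n m k l : ℕ` (casts to `ℤ` implicit):
`M⁺_G(n,m) = if n = 0 then G(0,m) else if m = 0 then G(n,0) else (G(n,m) + G(n,−m))/2`,
`M⁻_G(k,l) = (G(k+1,l+1) − G(k+1,−(l+1)))/2`.
Pure bookkeeping; standard axioms; nothing is defined; no RH claim (a rung `WeilPositivityOn a` is one case of the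
tree's `riemannHypothesis_iff_forall_weilPositivityOn`).
-/

set_option autoImplicit false
-- `Summit.RiemannHypothesis.RiemannHypothesis.…` is the layout-mandated namespace (summit = problem name).
set_option linter.dupNamespace false

noncomputable section

open Complex Finset
open scoped Real ComplexConjugate BigOperators

namespace Summit.RiemannHypothesis.RiemannHypothesis.Theorems.WeilFormatC

open Literature.NumberTheory.LFunctions
open Literature.NumberTheory.LFunctions.Yoshida1992 (modes chi)

/-- **Sector kernels nonnegative ⟹ the full real form on `modes N` is nonnegative.**  Let `G : ℤ → ℤ → ℝ` satisfy
`G(−n,−m) = G(n,m)`.  If the even kernel `M⁺_G` and the odd kernel `M⁻_G` (module docstring) are nonnegative real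
quadratic forms on every `range K`, then `0 ≤ Σ_{n,m ∈ modes N} x_n x_m G(n,m)` for every `N` and every real `x`. -/
theorem sum_modes_mul_mul_nonneg_of_sector_kernels (G : ℤ → ℤ → ℝ) (hrefl : ∀ n m, G (-n) (-m) = G n m)
    (hev : ∀ (K : ℕ) (y : ℕ → ℝ), 0 ≤ ∑ n ∈ Finset.range K, ∑ m ∈ Finset.range K,
      y n * y m * (if n = 0 then G 0 m else if m = 0 then G n 0 else (G n m + G n (-(m : ℤ))) / 2))
    (hod : ∀ (K : ℕ) (z : ℕ → ℝ), 0 ≤ ∑ k ∈ Finset.range K, ∑ l ∈ Finset.range K,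
      z k * z l * ((G ((k : ℤ) + 1) ((l : ℤ) + 1) - G ((k : ℤ) + 1) (-((l : ℤ) + 1))) / 2))
    (N : ℕ) (x : ℤ → ℝ) :
    0 ≤ ∑ n ∈ modes N, ∑ m ∈ modes N, x n * x m * G n m := by
  rw [sum_modes_mul_mul_eq_sectors G hrefl N x]
  exact add_nonneg (hev (N + 1) fun n ↦ if n = 0 then x 0 else x n + x (-(n : ℤ)))
    (hod N fun k ↦ x ((k : ℤ) + 1) - x (-((k : ℤ) + 1)))

variable {a : ℝ}

/-- Real Gram entries: if `weilWindowSesq a χ_m χ_n = ↑(G m n)` then the imaginary parts vanish. -/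
theorem im_weilWindowSesq_chi_eq_zero_of_eq (G : ℤ → ℤ → ℝ)
    (hG : ∀ m n : ℤ, weilWindowSesq a (chi a m) (chi a n) = ((G m n : ℝ) : ℂ)) (m n : ℤ) :
    (weilWindowSesq a (chi a m) (chi a n)).im = 0 := by
  rw [hG m n, Complex.ofReal_im]

/-- **Format C, sector kernels ⟹ a rung.**  Let `a > 0` and let `G : ℤ → ℤ → ℝ` be the (real) Gram kernel of the
window form on Yoshida's basis, `weilWindowSesq a χ_m χ_n = ↑(G m n)`, with the reflection symmetry
`G(−n,−m) = G(n,m)`.  If the even sector kernel `M⁺_G` and the odd sector kernel `M⁻_G` are nonnegative real quadratic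
forms on every `range K` (the conclusion of `sum_range_mul_mul_nonneg_of_certificate` for each sector), then
`WeilPositivityOn a`. -/
theorem weilPositivityOn_of_sector_kernels_nonneg (ha : 0 < a) (G : ℤ → ℤ → ℝ)
    (hG : ∀ m n : ℤ, weilWindowSesq a (chi a m) (chi a n) = ((G m n : ℝ) : ℂ))
    (hrefl : ∀ n m, G (-n) (-m) = G n m)
    (hev : ∀ (K : ℕ) (y : ℕ → ℝ), 0 ≤ ∑ n ∈ Finset.range K, ∑ m ∈ Finset.range K,
      y n * y m * (if n = 0 then G 0 m else if m = 0 then G n 0 else (G n m + G n (-(m : ℤ))) / 2))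
    (hod : ∀ (K : ℕ) (z : ℕ → ℝ), 0 ≤ ∑ k ∈ Finset.range K, ∑ l ∈ Finset.range K,
      z k * z l * ((G ((k : ℤ) + 1) ((l : ℤ) + 1) - G ((k : ℤ) + 1) (-((l : ℤ) + 1))) / 2)) :
    WeilPositivityOn a := by
  refine weilPositivityOn_of_real_gram_psd ha (im_weilWindowSesq_chi_eq_zero_of_eq G hG) fun N x ↦ ?_
  have e : ∑ m ∈ modes N, ∑ n ∈ modes N, x m * x n * (weilWindowSesq a (chi a m) (chi a n)).re
      = ∑ n ∈ modes N, ∑ m ∈ modes N, x n * x m * G n m := by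
    refine Finset.sum_congr rfl fun m _ ↦ Finset.sum_congr rfl fun n _ ↦ ?_
    rw [hG m n, Complex.ofReal_re]
  rw [e]
  exact sum_modes_mul_mul_nonneg_of_sector_kernels G hrefl hev hod N x

end Summit.RiemannHypothesis.RiemannHypothesis.Theorems.WeilFormatC

end
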